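import Summits.ValiantsHypothesis.ValiantsHypothesis.Theorems.AnyonJetsConstantFreeJetGrowthDefs
import Literature.Computability.AlgebraicComplexity.PermanentBitsPPoly
import Literature.Computability.AlgebraicComplexity.BurgisserBooleanPartsModPCircuits
import HarnessLib

/-!
# AnyonJets — crux `ConstantFreeJetGrowth` (stmt-ValiantsHypothesis-16738), line `birth`:
# stub `stub_booleanSimulation` (Boolean simulation mod `2^k` at 0/1 inputs)

Route `ValiantsHypothesis/AnyonJets`, crux `ConstantFreeJetGrowth`, registered line
`Cruxes/ConstantFreeJetGrowth/Lines/birth.lean` (objects in the companion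
`Theorems/AnyonJetsConstantFreeJetGrowthDefs.lean`, verbatim the line's §0). This file proves stub C
of the line, verbatim, with `d = 7`:

* `stub_booleanSimulation` — for every integer polynomial `f` on the `n × n` matrix, the `k` bits of
  `f(y) mod 2^k` (`y` a 0/1 point) have `B₂`-circuits of size `((L_ℤ(f) + 2)(k + 2))^7`.

Proof: Bürgisser's Boolean simulation of an optimal integer circuit modulo `p = 2^k` (tree
`cktSize_testBits_aeval_eval`, PROVED; input residues `[y v] ∈ {0,1}` cost one gate,
`cktSize_inputResidue`; size `(L+1)·gateCost k 1 ≤ (L+1)(2 + 65(k+2)^3) ≤ ((L+2)(k+2))^7` by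
`gateCost_le`); `k = 0` is the empty output. The same instantiation is run inline in the tree's
`AnyonJetsBooleanShadowToCF.lean` for the sibling support item `BooleanShadowToCF`.

Honest framing: a «provable now» stub; the crux's content (`stub_perModPowBooleanHard`) is untouched
and the crux stays OPEN; VP ≠ VNP is NOT proved here.
-/

noncomputable section

-- the summit and the problem share the name `ValiantsHypothesis` (D-0017 single-conjunct layout)
set_option linter.dupNamespace false

namespace Summit.ValiantsHypothesis.ValiantsHypothesis.Theorems.AnyonJets.ConstantFreeJetGrowth

open Literature.Computability.AlgebraicComplexity
open Literature.Computability.Complexity (CktSize B2)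

/-- **Stub C — Boolean simulation mod `2^k` at 0/1 inputs** (registered obligation
`stub_booleanSimulation` of crux `ConstantFreeJetGrowth`, line `birth`; signature verbatim; `d = 7`):
the `k` bits of `f(y) mod 2^k` cost `((L_ℤ(f) + 2)(k + 2))^7` `B₂`-gates.
[cite: Burgisser2000TCS, §5 (A3) p. 85] -/
theorem stub_booleanSimulation :
    ∃ d : ℕ, ∀ (n k : ℕ) (f : MvPolynomial (Fin n × Fin n) ℤ),
      CktSize B2 (fun (y : Fin n × Fin n → Bool) (i : Fin k) =>
          Nat.testBit (MvPolynomial.aeval (zeroOne k y) f).val i)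
        (((complexity f + 2) * (k + 2)) ^ d) := by
  refine ⟨7, fun n k f => ?_⟩
  rcases Nat.eq_zero_or_pos k with rfl | hk
  · exact (CktSize.of_isEmpty B2 _).of_le (Nat.zero_le _)
  obtain ⟨P, hP2, hPf, hPs⟩ := ArithCircuit.exists_computes_size_eq_complexity f
  haveI : NeZero (2 ^ k) := ⟨pow_ne_zero _ two_ne_zero⟩
  have hsim := cktSize_testBits_aeval_eval (p := 2 ^ k) (ℓ := k) le_rfl
    (fun (y : Fin n × Fin n → Bool) (v : Fin n × Fin n) => if y v then (1 : ZMod (2 ^ k)) else 0)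
    (fun v => cktSize_inputResidue hk v) P hP2
  refine (hsim.congr fun y i => ?_).of_le ?_
  · rw [testBits_apply]
    have : P.eval = f := hPf
    rw [this]
    rfl
  · rw [hPs]
    refine le_trans (Nat.mul_le_mul_left _ (gateCost_le k 1)) ?_
    -- `(L+1)(2 + 65(k+2)^3) ≤ ((L+2)(k+2))^7`
    set L := complexity f
    have h1 : (L + 1) * (2 * 1 + 65 * (k + 2) ^ 3) ≤ (L + 2) * (67 * (k + 2) ^ 3) := by
      have : 1 ≤ (k + 2) ^ 3 := Nat.one_le_pow _ _ (by omega)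
      nlinarith
    have h2 : 67 * (k + 2) ^ 3 ≤ (L + 2) ^ 6 * (k + 2) ^ 7 := by
      have ha : 64 ≤ (L + 2) ^ 6 := le_trans (by norm_num) (Nat.pow_le_pow_left (show 2 ≤ L + 2 by omega) 6)
      have hb : 16 * (k + 2) ^ 3 ≤ (k + 2) ^ 7 := by
        have : 16 ≤ (k + 2) ^ 4 := le_trans (by norm_num) (Nat.pow_le_pow_left (show 2 ≤ k + 2 by omega) 4)
        calc 16 * (k + 2) ^ 3 ≤ (k + 2) ^ 4 * (k + 2) ^ 3 := Nat.mul_le_mul_right _ this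
          _ = (k + 2) ^ 7 := by ring
      calc 67 * (k + 2) ^ 3 ≤ 64 * (16 * (k + 2) ^ 3) := by omega
        _ ≤ (L + 2) ^ 6 * (k + 2) ^ 7 := Nat.mul_le_mul ha hb
    calc (L + 1) * (2 * 1 + 65 * (k + 2) ^ 3)
        ≤ (L + 2) * (67 * (k + 2) ^ 3) := h1
      _ ≤ (L + 2) * ((L + 2) ^ 6 * (k + 2) ^ 7) := Nat.mul_le_mul_left _ h2
      _ = ((L + 2) * (k + 2)) ^ 7 := by ring

end Summit.ValiantsHypothesis.ValiantsHypothesis.Theorems.AnyonJets.ConstantFreeJetGrowth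

end
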